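import Summits.HodgeConjecture.HodgeConjecture.Theorems.F0P3cStCharTSShellVal    -- ★ p849069 (this seat) D1 «SHELL-VAL»: `valuation_charpoly_coeff_shell_three`
import Mathlib.GroupTheory.DoubleCoset
import Mathlib.LinearAlgebra.Matrix.GeneralLinearGroup.Defs
import HarnessLib

/-!
# F0 · P3c · line LH6 «StCharTS» — road (D) «DEEP-FL», brick D3-iii-hom «SHELL PATTERN THROUGH A MATRIX MODEL»: for a group `G` read in `GL₃(K)` by a hom `E`
# (the one-place model ★ `localNonsplitEquiv`), every element of the shell `K_n (z·aᵐ) K_n` — `K_n` of level `r < 1` under `E`, `z` scalar under `E`, `a` the ray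
# `diag(α, 1, α′)` with `|α| < 1`, `|α′| = |α|⁻¹` — has characteristic polynomial with the EXACT valuations `(|β||α|^{-m}, |β|²|α|^{-m}, |β|³)`

Cell `pub/hodgecm-mathlib`, crux H413 = `stmt-HodgeConjecture-24833` (`--supports` lane, helper), route HCCMUnconditional; seat LH6-p04 (g2), road (D) owner;
status v3 `F0/P3b/LH6-p04/g2/ROAD-D.status.v3.txt` brick D3-iii (CM instantiation, `G`-side core) — stated over an ABSTRACT hom `E : G →* GL₃(K)` into matrices
over a valued field so that the CM consumer only supplies ★ `localNonsplitEquiv` (as `E`), ★ `forall_mem_center_cmLocal_eq_scalar` (`E z` scalar), the ray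
hypothesis of «XIG» (`E a = diag(α, 1, (σα)⁻¹)`, ★ `valued_galAdicCompletionMap` for `|σα| = |α|`) and the level of `K_n` (`K_n ⊆ E⁻¹(1 + ϖᴺ M₃(𝒪))`).
THEOREMS ONLY, sorry-free, no definition ∕ instance ∕ notation ∕ named fact.  HONEST LABEL: HC_CM is proved only modulo the 7 printed citations (2 remaining:
hLiu418 = stmt-HodgeConjecture-24832, h413 = stmt-HodgeConjecture-24833) until rung 0 closes; count-neutral.

* `map_doubleCoset_eq` — `E(k₁ b k₂) = E k₁ · E b · E k₂` on `DoubleCoset.doubleCoset b K K` (bookkeeping).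
* `coe_pow_ray_eq_diagonal` — `E(aᵐ) = diag(αᵐ, 1, α′ᵐ)`; `coe_central_mul_pow_ray` — `E(z·aᵐ) = diag(βαᵐ, β, βα′ᵐ)` for `E z = β·1`.
* **`valuation_charpoly_coeff_of_mem_shell`** — for `x ∈ K_n (z aᵐ) K_n` (`m ≥ 1`, `0 < |α| < 1`, `|α′| = |α|⁻¹`, `|β| ≠ 0`, level `r < 1`):
  `v(coeff₂ charpoly(E x)) = |β|·|α′|ᵐ`, `v(coeff₁) = |β|²·|α′|ᵐ`, `v(coeff₀) = |β|³` (★ D1 with `d = (βαᵐ, β, βα′ᵐ)`).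
[Rogawski1990, §12.7 L. 12.7.3 proof p. 195 («`γ = d(α, β, ᾱ⁻¹)`, `‖α‖ < 1`»); Casselman1995 §1.5.]

## References
* [Rogawski1990] J. D. Rogawski, *Automorphic Representations of Unitary Groups in Three Variables*, Ann. of Math. Stud. 123 (1990), §12.7 p. 195; §4.9 p. 55.
* [Casselman1995] W. Casselman, *Introduction to the theory of admissible representations of p-adic reductive groups* (1995 notes), Prop. 1.4.4, §1.5.
-/

set_option autoImplicit false
-- the mandated namespace has the single-problem summit's repeated segment (`HodgeConjecture.HodgeConjecture`)
set_option linter.dupNamespace false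

open Matrix Polynomial
open scoped BigOperators MatrixGroups

namespace Summit.HodgeConjecture.HodgeConjecture.Cruxes.H413.F0P3cStCharTSShellPatternHom

variable {G : Type*} [Group G] {K : Type*} [Field K] {Γ₀ : Type*} [LinearOrderedCommGroupWithZero Γ₀] (v : Valuation K Γ₀)
  (E : G →* GL (Fin 3) K)

/-- On the shell: `x ∈ K b K'` ⇒ `E x = E k₁ · E b · E k₂` for some `k₁ ∈ K`, `k₂ ∈ K'`. [folklore] -/
theorem exists_coe_eq_of_mem_doubleCoset (Kg Kg' : Subgroup G) (b : G) {x : G} (hx : x ∈ DoubleCoset.doubleCoset b (Kg : Set G) Kg') :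
    ∃ k₁ ∈ Kg, ∃ k₂ ∈ Kg', ((E x : GL (Fin 3) K) : Matrix (Fin 3) (Fin 3) K) =
      ((E k₁ : GL (Fin 3) K) : Matrix (Fin 3) (Fin 3) K) * ((E b : GL (Fin 3) K) : Matrix (Fin 3) (Fin 3) K) * ((E k₂ : GL (Fin 3) K) : Matrix (Fin 3) (Fin 3) K) := by
  obtain ⟨k₁, hk₁, k₂, hk₂, rfl⟩ := DoubleCoset.mem_doubleCoset.1 hx
  exact ⟨k₁, hk₁, k₂, hk₂, by rw [map_mul, map_mul, Units.val_mul, Units.val_mul]⟩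

/-- `E(aᵐ) = diag(d₀ᵐ)` when `E a = diag(d₀)`. [folklore] -/
theorem coe_pow_eq_diagonal_pow {a : G} {d₀ : Fin 3 → K} (ha : ((E a : GL (Fin 3) K) : Matrix (Fin 3) (Fin 3) K) = diagonal d₀) (m : ℕ) :
    ((E (a ^ m) : GL (Fin 3) K) : Matrix (Fin 3) (Fin 3) K) = diagonal (d₀ ^ m) := by
  rw [map_pow, Units.val_pow_eq_pow_val, ha, diagonal_pow]

/-- `E(z·aᵐ) = diag(β·d₀ᵐ)` when `E z = β·1` and `E a = diag(d₀)`. [folklore] -/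
theorem coe_central_mul_pow_eq_diagonal {z a : G} {β : K} {d₀ : Fin 3 → K} (hz : ((E z : GL (Fin 3) K) : Matrix (Fin 3) (Fin 3) K) = β • (1 : Matrix (Fin 3) (Fin 3) K))
    (ha : ((E a : GL (Fin 3) K) : Matrix (Fin 3) (Fin 3) K) = diagonal d₀) (m : ℕ) :
    ((E (z * a ^ m) : GL (Fin 3) K) : Matrix (Fin 3) (Fin 3) K) = diagonal (fun i => β * d₀ i ^ m) := by
  rw [map_mul, Units.val_mul, coe_pow_eq_diagonal_pow E ha, hz, smul_mul_assoc, one_mul, smul_eq_diagonal_mul, diagonal_mul_diagonal]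
  rfl

/-- **THE SHELL PATTERN THROUGH `E`.**  Let `K_n ≤ G` be of LEVEL `r < 1` under `E` (`v((E k)ᵢⱼ − δᵢⱼ) ≤ r` for `k ∈ K_n`), `E z = β·1` with `v(β) ≠ 0`, `E a = diag(α, α₁, α′)` with
`v(α₁) = 1`, `0 < v(α) < 1`, `v(α)·v(α′) = 1`, and `m ≥ 1`.  Then every `x ∈ K_n (z aᵐ) K_n` has
`v(coeff₂ charpoly (E x)) = v(β)·v(α′)ᵐ`, `v(coeff₁ …) = v(β)²·v(α′)ᵐ`, `v(coeff₀ …) = v(β)³` — the exact valuations of ★ D1 at `d = (βαᵐ, βα₁ᵐ, βα′ᵐ)`.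
[cite: Rogawski1990, §12.7 L. 12.7.3 (proof) p. 195] [cite: Casselman1995, Prop. 1.4.4, §1.5] -/
theorem valuation_charpoly_coeff_of_mem_shell (Kn : Subgroup G) {r : Γ₀} (hr : r < 1)
    (hK : ∀ k ∈ Kn, ∀ i j, v (((E k : GL (Fin 3) K) : Matrix (Fin 3) (Fin 3) K) i j - (1 : Matrix (Fin 3) (Fin 3) K) i j) ≤ r)
    {z a : G} {β α α₁ α' : K} (hz : ((E z : GL (Fin 3) K) : Matrix (Fin 3) (Fin 3) K) = β • (1 : Matrix (Fin 3) (Fin 3) K))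
    (ha : ((E a : GL (Fin 3) K) : Matrix (Fin 3) (Fin 3) K) = diagonal ![α, α₁, α'])
    (hβ : v β ≠ 0) (hα0 : v α ≠ 0) (hα1 : v α < 1) (hα₁ : v α₁ = 1) (hαα' : v α * v α' = 1) {m : ℕ} (hm : 1 ≤ m)
    {x : G} (hx : x ∈ DoubleCoset.doubleCoset (z * a ^ m) (Kn : Set G) Kn) :
    v (((E x : GL (Fin 3) K) : Matrix (Fin 3) (Fin 3) K).charpoly.coeff 2) = v β * v α' ^ m ∧
      v (((E x : GL (Fin 3) K) : Matrix (Fin 3) (Fin 3) K).charpoly.coeff 1) = v β * (v β * v α' ^ m) ∧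
      v (((E x : GL (Fin 3) K) : Matrix (Fin 3) (Fin 3) K).charpoly.coeff 0) = v β * v α ^ m * (v β) * (v β * v α' ^ m) := by
  obtain ⟨k₁, hk₁, k₂, hk₂, hxe⟩ := exists_coe_eq_of_mem_doubleCoset E Kn Kn (z * a ^ m) hx
  have hb := coe_central_mul_pow_eq_diagonal E hz ha m
  -- the diagonal `d = (βαᵐ, βα₁ᵐ, βα′ᵐ)` and its strict valuation chain
  set d : Fin 3 → K := fun i => β * (![α, α₁, α'] i) ^ m with hd
  have hd0 : v (d 0) = v β * v α ^ m := by simp [hd, Valuation.map_mul, Valuation.map_pow]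
  have hd1 : v (d 1) = v β := by simp [hd, Valuation.map_mul, Valuation.map_pow, hα₁]
  have hd2 : v (d 2) = v β * v α' ^ m := by simp [hd, Valuation.map_mul, Valuation.map_pow]
  have hαm : v α ^ m < 1 := pow_lt_one₀ zero_le hα1 (by omega)
  have hα'gt : 1 < v α' := by
    by_contra hle
    rw [not_lt] at hle
    have : v α * v α' < 1 := by
      calc v α * v α' ≤ v α * 1 := mul_le_mul' le_rfl hle
        _ = v α := mul_one _
        _ < 1 := hα1
    rw [hαα'] at this
    exact lt_irrefl _ this
  have hα'm : 1 < v α' ^ m := one_lt_pow₀ hα'gt (by omega)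
  have hβpos : 0 < v β := zero_lt_iff.2 hβ
  have h01 : v (d 0) < v (d 1) := by
    rw [hd0, hd1]
    calc v β * v α ^ m < v β * 1 := mul_lt_mul_of_pos_left hαm hβpos
      _ = v β := mul_one _
  have h12 : v (d 1) < v (d 2) := by
    rw [hd1, hd2]
    calc v β = v β * 1 := (mul_one _).symm
      _ < v β * v α' ^ m := mul_lt_mul_of_pos_left hα'm hβpos
  have hd0ne : v (d 0) ≠ 0 := by
    rw [hd0]; exact mul_ne_zero hβ (pow_ne_zero m hα0)
  have hxd : ((E x : GL (Fin 3) K) : Matrix (Fin 3) (Fin 3) K) =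
      ((E k₁ : GL (Fin 3) K) : Matrix (Fin 3) (Fin 3) K) * diagonal d * ((E k₂ : GL (Fin 3) K) : Matrix (Fin 3) (Fin 3) K) := by
    rw [hxe, hb]
  obtain ⟨h2, h1, h0⟩ := F0P3cStCharTSShellVal.valuation_charpoly_coeff_shell_three v d _ _ hr (hK k₁ hk₁) (hK k₂ hk₂) hd0ne h01 h12
  rw [hxd]
  refine ⟨?_, ?_, ?_⟩
  · rw [h2, hd2]
  · rw [h1, hd1, hd2]
  · rw [h0, hd0, hd1, hd2]

/-- The constant coefficient simplifies: `v(coeff₀) = v(β)³` (since `v(α)·v(α′) = 1`). [cite: Rogawski1990, §12.7 p. 195] -/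
theorem valuation_charpoly_coeff_zero_of_mem_shell (Kn : Subgroup G) {r : Γ₀} (hr : r < 1)
    (hK : ∀ k ∈ Kn, ∀ i j, v (((E k : GL (Fin 3) K) : Matrix (Fin 3) (Fin 3) K) i j - (1 : Matrix (Fin 3) (Fin 3) K) i j) ≤ r)
    {z a : G} {β α α₁ α' : K} (hz : ((E z : GL (Fin 3) K) : Matrix (Fin 3) (Fin 3) K) = β • (1 : Matrix (Fin 3) (Fin 3) K))
    (ha : ((E a : GL (Fin 3) K) : Matrix (Fin 3) (Fin 3) K) = diagonal ![α, α₁, α'])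
    (hβ : v β ≠ 0) (hα0 : v α ≠ 0) (hα1 : v α < 1) (hα₁ : v α₁ = 1) (hαα' : v α * v α' = 1) {m : ℕ} (hm : 1 ≤ m)
    {x : G} (hx : x ∈ DoubleCoset.doubleCoset (z * a ^ m) (Kn : Set G) Kn) :
    v (((E x : GL (Fin 3) K) : Matrix (Fin 3) (Fin 3) K).charpoly.coeff 0) = v β ^ 3 := by
  obtain ⟨-, -, h0⟩ := valuation_charpoly_coeff_of_mem_shell v E Kn hr hK hz ha hβ hα0 hα1 hα₁ hαα' hm hx
  rw [h0]
  have : v α ^ m * v α' ^ m = 1 := by rw [← mul_pow, hαα', one_pow]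
  calc v β * v α ^ m * v β * (v β * v α' ^ m) = v β * v β * v β * (v α ^ m * v α' ^ m) := by ac_rfl
    _ = v β ^ 3 := by rw [this, mul_one, pow_succ, pow_two]

end Summit.HodgeConjecture.HodgeConjecture.Cruxes.H413.F0P3cStCharTSShellPatternHom
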